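import Literature.NumberTheory.Automorphic.Liu2021.AppendixC.HeckeTraceWordPiecesDeck
import Literature.NumberTheory.Automorphic.Liu2021.AppendixC.JacobianFanPullbackWordPinned
import Literature.AlgebraicGeometry.Morphisms.ClopenPieceOfCoproduct
import HarnessLib

/-!
# The trace word of the level cover with its MULTIPLICITY EXPOSED, and CONSTANT under Hecke-translate rigidity
# (Liu 2021 §4.2 / App. C; Lang VIII §6 Thm. 13; LR22 Prop. 3.5.1; Milne 2005 §5)

Topic `NumberTheory/Automorphic/Liu2021/AppendixC`; namespace `Literature.NumberTheory.Automorphic.Liu2021.AppendixC.Sec42Data.HeckeTranslates`.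
PROOF FILE (theorems only; no definition, no named fact, no instance, no `sorry`).  Sequel of ★ `HeckeTraceWordPiecesDeck` ((P-ii)+`hWd`:
the trace word `Wt = Σ_{c′} πY_K (bN c′) ≫ (m c′ • ttH c′) ≫ ιY_N c′` of the level cover `u : X_N → X_K`, `Wt ≫ v_N = v_K ≫ t_ℂ`, deck invariant)
and ★ `JacobianFanPullbackWordPinned` (the multiplicity exposed generically).  Setting and notation as there.

WHY.  ★ `exists_fan_traceWord(_deck)` hide `m c′` behind `∃`; the termwise weight matching of the d6 `slot_letters` closure (cell
`hodgecm-mathlib`, A-p18 (g12) 2026-08-30 06:00Z obstruction, (L)-pen ruling 06:09Z) needs it as a KNOWN integer, uniform in the piece.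
Generically it is the order of the POINTWISE STABILISER `{δ ∈ Δ | eN c′ ≫ (act δ)_ℂ = eN c′}` of the piece; for the unitary Shimura curve a
Hecke translate fixing a non-empty open of `X_N ⊗ ℂ` is the identity (rigidity, [Milne2005ShimuraVarieties] §5; record-derivable), so all
pointwise stabilisers are the global kernel of `act` and the multiplicity is ONE constant `m₀`.

* **`exists_fan_traceWord_card`** — ★ `exists_fan_traceWord_deck` with `m c′ := Nat.card {δ : Δ // eN c′ ≫ (bcFunctor E ℂ).map (act δ).hom = eN c′}`
  written into the statement (per-piece Galois data `(H, hq, ttH, httH)`, `0 < m c′`, `Wt ≫ v_N = v_K ≫ t_ℂ`, deck invariance);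
* **`exists_fan_traceWord_of_rigid`** — under `hPF : ∀ δ P [Nonempty] (e : P ⟶ X_N ⊗ ℂ) [IsOpenImmersion e.left], e ≫ (act δ)_ℂ = e → act δ = 1`
  (Hecke-translate rigidity as a hypothesis on the §4.2 tower): `∃ m₀ = Nat.card {δ // act δ = 1} ≥ 1` with the trace word `Σ πY_K (bN c′) ≫
  (m₀ • ttH c′) ≫ ιY_N c′`, its `v`-intertwining and deck invariance — the (PF) consumer shape of the d6 frame (`m₀ = 1` when `act` is injective).

Cell `hodgecm-mathlib` (D-0151), crux `HLiu418` = stmt-HodgeConjecture-24832, d6 line, `stub_RosH` glue.  COUNT-NEUTRAL capital: HC_CM is proved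
only modulo the 7 printed citations until rung 0 closes; `hPF` is a hypothesis here (discharged at the GS tower by the record, WO-HTR), not a
named fact.

## References
* [Liu2021] Y. Liu, *Fourier–Jacobi cycles and arithmetic relative trace formula*, Camb. J. Math. 9 (2021): §4.2 (FJcycle.tex l. 2070–2074),
  p. 133 (before (D.3)).
* [Lang1983AbelianVarieties] S. Lang, *Abelian Varieties* (1983), Ch. VIII §6 Thm. 13 (pp. 224–227).
* [LangeRodriguez2022] H. Lange, R. E. Rodríguez, *Decomposition of Jacobians by Prym Varieties*, LNM 2310 (2022), §3.5.1 Prop. 3.5.1 (p. 65).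
* [Milne2005ShimuraVarieties] J. S. Milne, *Introduction to Shimura varieties* (2005), §5 p. 57 L7–12, Rem. 5.29 (c) p. 65.
* [Deligne1979ShimuraVarieties] P. Deligne, *Variétés de Shimura*, Proc. Symp. Pure Math. 33 (1979), 2.1.2.
* [MumfordAV1970] D. Mumford, *Abelian Varieties* (1970), §7 Thm. p. 66 and Remark.
-/

set_option autoImplicit false

noncomputable section

open CategoryTheory CategoryTheory.Limits AlgebraicGeometry MonoidalCategory CartesianMonoidalCategory NumberField
open Literature.AlgebraicGeometry.Motives

namespace Literature.NumberTheory.Automorphic.Liu2021.AppendixC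

section Sec42

open AbelianVariety (bcSpec bcFunctor)

-- `(A.baseChange L).X` is `(bcFunctor E L).obj A.X` only up to unfolding `AbelianVariety.baseChange` (as in ★ `HeckeEndomorphismComplexWord`)
set_option backward.isDefEq.respectTransparency false

variable {F E : Type} [Field F] [NumberField F] [IsTotallyReal F] [Field E] [NumberField E] [Algebra F E]
  [IsTotallyComplex E] [Algebra.IsQuadraticExtension F E]
variable {P5 : PropC5Data F E} {isotropicAt : ℕ → Prop}

namespace Sec42Data.HeckeTranslates

variable {C : Sec42Data P5 isotropicAt} [Algebra E ℂ]
variable {N K : C5.SmallLevel C.S.K₀}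
-- piecewise model of `A_N ⊗ ℂ`, with its fan `πN/ιN`
variable {CN : Type} [Fintype CN] (EN : CN → SchemeOver ℂ) (eN : ∀ c, EN c ⟶ (bcFunctor E ℂ).obj (C.X N))
  (JN : ∀ c, Jacobian (EN c)) (YN : AbelianVariety ℂ) (πN : ∀ c, YN ⟶ (JN c).J) (ιN : ∀ c, (JN c).J ⟶ YN)
  (vN : YN ⟶ (C.A N).baseChange ℂ) (lN : ∀ c, EN c ⊗ EN c ⟶ (bcFunctor E ℂ).obj (C.alb N).nabla.N)
-- piecewise model of `A_K ⊗ ℂ`, with its fan `πK/ιK`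
variable {CK : Type} [Fintype CK] (EK : CK → SchemeOver ℂ) (eK : ∀ c, EK c ⟶ (bcFunctor E ℂ).obj (C.X K))
  (JK : ∀ c, Jacobian (EK c)) (YK : AbelianVariety ℂ) (πK : ∀ c, YK ⟶ (JK c).J) (ιK : ∀ c, (JK c).J ⟶ YK)
  (vK : YK ⟶ (C.A K).baseChange ℂ) (lK : ∀ c, EK c ⊗ EK c ⟶ (bcFunctor E ℂ).obj (C.alb K).nabla.N)

/-- **(P-ii) THE TRACE WORD OF THE LEVEL COVER IN MATRIX FORM, WITH ITS DECK INVARIANCE AND ITS MULTIPLICITY EXPOSED** (d6 `stub_RosH`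
glue, socket (G3)+`hWd` of the frame's `slot_letters`; = ★ `exists_fan_traceWord_deck` with `∃ m` replaced by the explicit count
`m c′ := Nat.card {δ : Δ // eN c′ ≫ (act δ)_ℂ = eN c′}` — the order of the POINTWISE STABILISER of the piece `c′` in the deck group).
Data: small levels `N ≤ K`; the level projection `u : X_N → X_K` realised as a quotient of `X_N` by a FINITE group `act : Δ →* Aut X_N` for
separated test objects ([Milne2005ShimuraVarieties] §5 «`Sh_K = Sh_{K′}/(K/K′)`»; ★ `exists_finite_isSepQuotient_map'`); an Albanese trace
`t : A_K → A_N` of `u` pinned by the deck group, `Alb_u ≫ t = Σ_δ Alb(act δ)` ([Lang1983AbelianVarieties] VIII §6 Thm. 13; ★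
`Albanese.exists_trace_of_isSepQuotient_complex`); piecewise complex models of `A_N ⊗ ℂ`, `A_K ⊗ ℂ` (smooth projective curves
`E_• c → X_• ⊗ ℂ` forming colimit cofans, Jacobians, biproduct fans `π/ι` on `Y_•`, comparison maps `v_•`, `α`-compatibilities — the
`GSComplexModel` fields); the piece maps `tu c′ : E_N c′ → E_K (bN c′)` of `u_ℂ`.  THEN for every piece `c′` there are: the finite group
`H c′ ≤ Aut (E_N c′)` of lifts of its stabiliser, for which `tu c′` IS A QUOTIENT for separated test objects (the `Hu`/`hqu` input of ★
`Jacobian.exists_entry_levelAdjoint`); the pinned pull-back `ttH c′` (`Nm_{tu c′} ≫ ttH c′ = Σ_{h ∈ H c′} h_*`, its `tt`/`htt` input); a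
multiplicity `m c′ ≥ 1` (`= #ker(Stab_Δ(c′) → Aut (E_N c′))`; `= 1` iff `K/N` acts piecewise faithfully); and THE TRACE WORD INTERTWINES `t`:
**`(Σ_{c′} πY_K (bN c′) ≫ (m c′ • ttH c′) ≫ ιY_N c′) ≫ v_N = v_K ≫ t_ℂ`** — the `(bN, tt := m • ttH, hWt)` input of ★
`algEquiv_symm_endAlgebraBaseChange_heckeEnd_eq_smul_fan_sum`; AND the DECK INVARIANCE of that word at the Y-level: for every `δ ∈ Δ` and
every lift family `cs : C_N → C_N`, `dk c : E_N c → E_N (cs c)` of `(act δ)_ℂ` through the pieces,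
**`(Σ_{c′} πY_K (bN c′) ≫ (m c′ • ttH c′) ≫ ιY_N c′) ≫ (Σ_c πY_N c ≫ Nm_{dk c} ≫ ιY_N (cs c)) = Σ_{c′} πY_K (bN c′) ≫ (m c′ • ttH c′) ≫ ιY_N c′`** —
the `hWd` input of ★ `HeckeEndomorphismTransposedWordScalar` / ★ `fan_entry_deck_invariant` (there `cs := (d • ·)`, `Tκ d := (act δ_d)_ℂ`).  Proof:
★ `Jacobian.exists_fan_pullback_word_deck` on `u_ℂ` and the cancellation argument of ★ `trace_baseChange_word_of_cancel` ([LangeRodriguez2022]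
Prop. 3.5.1: `u^* ≫ δ_* = u^*`).
[cite: Lang1983AbelianVarieties, Ch. VIII §6, Thm. 13 (pp. 224–227)] [cite: LangeRodriguez2022, §3.5.1 Prop. 3.5.1 (p. 65)]
[cite: Liu2021, §4.2 (FJcycle.tex l. 2070–2074) and p. 133 (before (D.3))] [cite: Milne2005ShimuraVarieties, §5 p. 57 L7–12 and Rem. 5.29 (c) p. 65]
[cite: MumfordAV1970, §7 Thm. p. 66 and Remark] -/
theorem exists_fan_traceWord_card (h : N ≤ K)
    {Δ : Type} [Group Δ] [Fintype Δ] (act : Δ →* Aut (C.X N))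
    (hp : IsSepQuotient (fun δ => act δ) (C.cpt.X.map (homOfLE h)))
    (t : C.A K ⟶ C.A N)
    (ht : (C.alb N).map (C.alb K) (C.cpt.X.map (homOfLE h)) ≫ t = ∑ δ, (C.alb N).map (C.alb N) (act δ).hom)
    (hcN : IsColimit (Cofan.mk ((bcFunctor E ℂ).obj (C.X N)) eN)) (hEN : ∀ c, IsSmoothProjective 1 (EN c))
    (hcK : IsColimit (Cofan.mk ((bcFunctor E ℂ).obj (C.X K)) eK)) (hEK : ∀ c, IsSmoothProjective 1 (EK c))
    (htotN : ∑ c, πN c ≫ ιN c = 𝟙 YN) (hιπN : ∀ c, ιN c ≫ πN c = 𝟙 _) (hιπN' : ∀ c₁ c₂, c₁ ≠ c₂ → ιN c₁ ≫ πN c₂ = 0)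
    (htotK : ∑ c, πK c ≫ ιK c = 𝟙 YK) (hιπK : ∀ c, ιK c ≫ πK c = 𝟙 _) (hιπK' : ∀ c₁ c₂, c₁ ≠ c₂ → ιK c₁ ≫ πK c₂ = 0)
    (hlN : ∀ c, lN c ≫ (bcFunctor E ℂ).map (C.alb N).nabla.incl = (eN c ⊗ₘ eN c) ≫ Functor.LaxMonoidal.μ (bcFunctor E ℂ) (C.X N) (C.X N))
    (hlαN : ∀ c, lN c ≫ (bcFunctor E ℂ).map (C.alb N).α = (JN c).diff ≫ (ιN c ≫ vN).hom.hom.hom)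
    (hlK : ∀ c, lK c ≫ (bcFunctor E ℂ).map (C.alb K).nabla.incl = (eK c ⊗ₘ eK c) ≫ Functor.LaxMonoidal.μ (bcFunctor E ℂ) (C.X K) (C.X K))
    (hlαK : ∀ c, lK c ≫ (bcFunctor E ℂ).map (C.alb K).α = (JK c).diff ≫ (ιK c ≫ vK).hom.hom.hom)
    (bN : CN → CK) (tu : ∀ c', EN c' ⟶ EK (bN c'))
    (htu : ∀ c', tu c' ≫ eK (bN c') = eN c' ≫ (bcFunctor E ℂ).map (C.cpt.X.map (homOfLE h))) :
    ∃ (H : ∀ c', Subgroup (Aut (EN c'))) (_ : ∀ c', Finite ↥(H c'))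
      (_ : ∀ c', IsSepQuotient (fun h : ↥(H c') => (h : Aut (EN c'))) (tu c'))
      (ttH : ∀ c', (JK (bN c')).J ⟶ (JN c').J),
      (∀ c', 0 < Nat.card {δ : Δ // eN c' ≫ (bcFunctor E ℂ).map (act δ).hom = eN c'}) ∧
      (∀ c', haveI := Fintype.ofFinite ↥(H c');
        (JN c').pushforward (JK (bN c')) (tu c') ≫ ttH c' =
          ∑ h : ↥(H c'), (JN c').pushforward (JN c') (h : Aut (EN c')).hom) ∧
      (∑ c', πK (bN c') ≫ ((Nat.card {δ : Δ // eN c' ≫ (bcFunctor E ℂ).map (act δ).hom = eN c'} : ℤ) • ttH c') ≫ ιN c') ≫ vN =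
        vK ≫ AbelianVariety.Hom.baseChange ℂ t ∧
      (∀ (δ : Δ) (cs : CN → CN) (dk : ∀ c, EN c ⟶ EN (cs c)),
        (∀ c, dk c ≫ eN (cs c) = eN c ≫ (bcFunctor E ℂ).map (act δ).hom) →
        (∑ c', πK (bN c') ≫ ((Nat.card {δ : Δ // eN c' ≫ (bcFunctor E ℂ).map (act δ).hom = eN c'} : ℤ) • ttH c') ≫ ιN c') ≫
            (∑ c, πN c ≫ (JN c).pushforward (JN (cs c)) (dk c) ≫ ιN (cs c)) =
          ∑ c', πK (bN c') ≫ ((Nat.card {δ : Δ // eN c' ≫ (bcFunctor E ℂ).map (act δ).hom = eN c'} : ℤ) • ttH c') ≫ ιN c') := by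
  classical
  haveI : ∀ c, IsIntegral (EN c).left := fun c => IsSmoothProjective.isIntegral_holds (hEN c)
  -- the complexified deck action and quotient
  let actC : Δ →* Aut ((bcFunctor E ℂ).obj (C.X N)) :=
    { toFun := fun δ => (bcFunctor E ℂ).mapIso (act δ)
      map_one' := by rw [map_one]; exact (bcFunctor E ℂ).mapIso_refl _
      map_mul' := fun a b => by rw [map_mul]; exact (bcFunctor E ℂ).mapIso_trans (act b) (act a) }
  have hactC : ∀ δ, (actC δ).hom = (bcFunctor E ℂ).map (act δ).hom := fun δ => rfl
  have hXK : IsSeparated (C.X K).hom := by haveI := (C.cpt.projective_X K).isProper; infer_instance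
  obtain ⟨hXsep, hpC⟩ := isSepQuotient_baseChangeHom_of_isProjectiveOver E (algebraMap E ℂ) Δ (C.X N) (C.X K)
    (C.cpt.projective_X N) act (C.cpt.X.map (homOfLE h)) hXK hp
  have hpC' : IsSepQuotient (fun δ => actC δ) ((bcFunctor E ℂ).map (C.cpt.X.map (homOfLE h))) := hpC
  have hXsep' : IsSeparated ((bcFunctor E ℂ).obj (C.X K)).hom := hXsep
  have hX'proj : IsProjectiveOver ((bcFunctor E ℂ).obj (C.X N)) := (C.cpt.projective_X N).baseChange_obj (L := ℂ)
  -- piece lifts of the deck automorphisms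
  have hl := fun δ c₁ => exists_pieceLift actC eN hcN δ c₁
  choose φδ tδ htδ using hl
  -- §1 on the complexified cover
  have hpiece := fun c' => Jacobian.exists_piece_pullback_pinned_card actC ((bcFunctor E ℂ).map (C.cpt.X.map (homOfLE h)))
    EN eN JN EK eK JK bN tu hX'proj hXsep' hpC' hcN hEN hcK hEK htu c'
  choose H hfin hq ttH hm httH hpin using hpiece
  have hpinY := Jacobian.fan_pinning_of_pinned actC ((bcFunctor E ℂ).map (C.cpt.X.map (homOfLE h))) EN eN JN EK eK JK bN tu πN ιN πK ιK
    hιπK hιπK' hX'proj hXsep' hpC' hcN hEN hcK hEK htu φδ tδ htδ _ hpin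
  have hcancel := Jacobian.fan_word_cancel actC ((bcFunctor E ℂ).map (C.cpt.X.map (homOfLE h))) EN eN JN EK eK JK bN tu πN ιN πK ιK
    hιπN hιπN' htotK hX'proj hXsep' hpC' hcN hEN hcK hEK htu H hq
  have hdeck := Jacobian.fan_deck_of_pinned actC ((bcFunctor E ℂ).map (C.cpt.X.map (homOfLE h))) EN eN JN EK eK JK bN tu πN ιN πK ιK
    hιπN hιπN' htotK hιπK hιπK' hX'proj hXsep' hpC' hcN hEN hcK hEK htu φδ tδ htδ _ hpin H hq
  have hpinY' : (∑ c', πN c' ≫ (JN c').pushforward (JK (bN c')) (tu c') ≫ ιK (bN c')) ≫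
      (∑ c', πK (bN c') ≫ ((Nat.card {δ : Δ // eN c' ≫ (bcFunctor E ℂ).map (act δ).hom = eN c'} : ℤ) • ttH c') ≫ ιN c') =
      ∑ δ, ∑ c', πN c' ≫ (JN c').pushforward (JN (φδ δ c')) (tδ δ c') ≫ ιN (φδ δ c') := hpinY
  refine ⟨H, hfin, hq, ttH, hm, httH, hcancel ?_, fun δ cs dk hdk => hdeck δ cs dk hdk⟩
  -- the deck words intertwine the Albanese maps (N1), the trace word is pinned (§1), cancel the word of `u`
  have hWu := map_baseChange_word EN eN JN YN πN ιN vN lN EK eK JK YK ιK vK lK htotN hlN hlαN hlK hlαK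
    (C.cpt.X.map (homOfLE h)) bN tu htu
  have hWδ : ∀ δ, vN ≫ AbelianVariety.Hom.baseChange ℂ ((C.alb N).map (C.alb N) (act δ).hom) =
      (∑ c', πN c' ≫ (JN c').pushforward (JN (φδ δ c')) (tδ δ c') ≫ ιN (φδ δ c')) ≫ vN := fun δ =>
    map_baseChange_word EN eN JN YN πN ιN vN lN EN eN JN YN ιN vN lN htotN hlN hlαN hlN hlαN (act δ).hom (φδ δ) (tδ δ)
      (htδ δ)
  have hsum : vN ≫ AbelianVariety.Hom.baseChange ℂ (∑ δ, (C.alb N).map (C.alb N) (act δ).hom) =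
      (∑ δ, ∑ c', πN c' ≫ (JN c').pushforward (JN (φδ δ c')) (tδ δ c') ≫ ιN (φδ δ c')) ≫ vN := by
    have e1 : AbelianVariety.Hom.baseChange ℂ (∑ δ, (C.alb N).map (C.alb N) (act δ).hom) =
        ∑ δ, AbelianVariety.Hom.baseChange ℂ ((C.alb N).map (C.alb N) (act δ).hom) :=
      map_sum (AddMonoidHom.mk' (fun g : C.A N ⟶ C.A N => AbelianVariety.Hom.baseChange ℂ g)
        (AbelianVariety.Hom.baseChange_add ℂ)) _ _
    rw [e1, Preadditive.comp_sum, Preadditive.sum_comp]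
    exact Finset.sum_congr rfl fun δ _ => hWδ δ
  rw [← Category.assoc, hpinY', ← hsum, ← ht, AbelianVariety.Hom.baseChange_comp, ← Category.assoc, hWu, Category.assoc]


/-- **THE TRACE WORD UNDER HECKE-TRANSLATE RIGIDITY: a CONSTANT multiplicity** ((L)-pen ruling (PF), 2026-08-30 06:09Z).  If a deck
transformation that restricts to the identity along some open immersion from a non-empty scheme into `X_N ⊗ ℂ` is the identity
(`hPF` — for the unitary Shimura curve a THEOREM of the record, «Hecke-translate rigidity»: a translate fixing a non-empty open of one
connected component is `T_z = 𝟙`, `z` central; [Milne2005ShimuraVarieties] §5, [Deligne1979ShimuraVarieties] 2.1.2), then every pointwise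
stabiliser `{δ | eN c′ ≫ (act δ)_ℂ = eN c′}` is the global kernel `{δ | act δ = 1}`, so the multiplicity of `exists_fan_traceWord_card` is ONE
integer `m₀ = #{δ | act δ = 1} ≥ 1` for all pieces: the trace word is `Σ_{c′} πY_K (bN c′) ≫ (m₀ • ttH c′) ≫ ιY_N c′` (with its `v`-intertwining,
deck invariance, and the per-piece Galois data `(H, hq, ttH, httH)` of ★ `Jacobian.exists_entry_levelAdjoint`).
[cite: Lang1983AbelianVarieties, Ch. VIII §6, Thm. 13 (pp. 224–227)] [cite: LangeRodriguez2022, §3.5.1 Prop. 3.5.1 (p. 65)]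
[cite: Milne2005ShimuraVarieties, §5 p. 57 L7–12 and Rem. 5.29 (c) p. 65] [cite: MumfordAV1970, §7 Thm. p. 66 and Remark] -/
theorem exists_fan_traceWord_of_rigid (h : N ≤ K)
    {Δ : Type} [Group Δ] [Fintype Δ] (act : Δ →* Aut (C.X N))
    (hp : IsSepQuotient (fun δ => act δ) (C.cpt.X.map (homOfLE h)))
    (hPF : ∀ (δ : Δ) (P : SchemeOver ℂ) [Nonempty ↥P.left] (e : P ⟶ (bcFunctor E ℂ).obj (C.X N)) [IsOpenImmersion e.left],
      e ≫ (bcFunctor E ℂ).map (act δ).hom = e → act δ = 1)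
    (t : C.A K ⟶ C.A N)
    (ht : (C.alb N).map (C.alb K) (C.cpt.X.map (homOfLE h)) ≫ t = ∑ δ, (C.alb N).map (C.alb N) (act δ).hom)
    (hcN : IsColimit (Cofan.mk ((bcFunctor E ℂ).obj (C.X N)) eN)) (hEN : ∀ c, IsSmoothProjective 1 (EN c))
    (hcK : IsColimit (Cofan.mk ((bcFunctor E ℂ).obj (C.X K)) eK)) (hEK : ∀ c, IsSmoothProjective 1 (EK c))
    (htotN : ∑ c, πN c ≫ ιN c = 𝟙 YN) (hιπN : ∀ c, ιN c ≫ πN c = 𝟙 _) (hιπN' : ∀ c₁ c₂, c₁ ≠ c₂ → ιN c₁ ≫ πN c₂ = 0)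
    (htotK : ∑ c, πK c ≫ ιK c = 𝟙 YK) (hιπK : ∀ c, ιK c ≫ πK c = 𝟙 _) (hιπK' : ∀ c₁ c₂, c₁ ≠ c₂ → ιK c₁ ≫ πK c₂ = 0)
    (hlN : ∀ c, lN c ≫ (bcFunctor E ℂ).map (C.alb N).nabla.incl = (eN c ⊗ₘ eN c) ≫ Functor.LaxMonoidal.μ (bcFunctor E ℂ) (C.X N) (C.X N))
    (hlαN : ∀ c, lN c ≫ (bcFunctor E ℂ).map (C.alb N).α = (JN c).diff ≫ (ιN c ≫ vN).hom.hom.hom)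
    (hlK : ∀ c, lK c ≫ (bcFunctor E ℂ).map (C.alb K).nabla.incl = (eK c ⊗ₘ eK c) ≫ Functor.LaxMonoidal.μ (bcFunctor E ℂ) (C.X K) (C.X K))
    (hlαK : ∀ c, lK c ≫ (bcFunctor E ℂ).map (C.alb K).α = (JK c).diff ≫ (ιK c ≫ vK).hom.hom.hom)
    (bN : CN → CK) (tu : ∀ c', EN c' ⟶ EK (bN c'))
    (htu : ∀ c', tu c' ≫ eK (bN c') = eN c' ≫ (bcFunctor E ℂ).map (C.cpt.X.map (homOfLE h))) :
    ∃ (m₀ : ℕ) (H : ∀ c', Subgroup (Aut (EN c'))) (_ : ∀ c', Finite ↥(H c'))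
      (_ : ∀ c', IsSepQuotient (fun h : ↥(H c') => (h : Aut (EN c'))) (tu c'))
      (ttH : ∀ c', (JK (bN c')).J ⟶ (JN c').J),
      0 < m₀ ∧ m₀ = Nat.card {δ : Δ // act δ = 1} ∧
      (∀ c', haveI := Fintype.ofFinite ↥(H c');
        (JN c').pushforward (JK (bN c')) (tu c') ≫ ttH c' =
          ∑ h : ↥(H c'), (JN c').pushforward (JN c') (h : Aut (EN c')).hom) ∧
      (∑ c', πK (bN c') ≫ ((m₀ : ℤ) • ttH c') ≫ ιN c') ≫ vN = vK ≫ AbelianVariety.Hom.baseChange ℂ t ∧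
      (∀ (δ : Δ) (cs : CN → CN) (dk : ∀ c, EN c ⟶ EN (cs c)),
        (∀ c, dk c ≫ eN (cs c) = eN c ≫ (bcFunctor E ℂ).map (act δ).hom) →
        (∑ c', πK (bN c') ≫ ((m₀ : ℤ) • ttH c') ≫ ιN c') ≫
            (∑ c, πN c ≫ (JN c).pushforward (JN (cs c)) (dk c) ≫ ιN (cs c)) =
          ∑ c', πK (bN c') ≫ ((m₀ : ℤ) • ttH c') ≫ ιN c') := by
  classical
  haveI : ∀ c, IsIntegral (EN c).left := fun c => IsSmoothProjective.isIntegral_holds (hEN c)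
  obtain ⟨H, hfin, hq, ttH, hm, httH, hWt, hdeck⟩ :=
    exists_fan_traceWord_card EN eN JN YN πN ιN vN lN EK eK JK YK πK ιK vK lK h act hp t ht hcN hEN hcK hEK htotN hιπN hιπN' htotK
      hιπK hιπK' hlN hlαN hlK hlαK bN tu htu
  -- under rigidity every pointwise stabiliser is the global kernel
  obtain ⟨hcN'⟩ := Literature.AlgebraicGeometry.Morphisms.isColimit_cofan_left hcN
  have hker : ∀ c', Nat.card {δ : Δ // eN c' ≫ (bcFunctor E ℂ).map (act δ).hom = eN c'} = Nat.card {δ : Δ // act δ = 1} := by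
    intro c'
    haveI : IsOpenImmersion (eN c').left := Literature.AlgebraicGeometry.Morphisms.isOpenImmersion_of_isColimit_cofan hcN' c'
    refine Nat.card_congr (Equiv.subtypeEquivRight fun δ => ⟨fun hδ => hPF δ (EN c') (eN c') hδ, fun hδ => ?_⟩)
    rw [hδ]
    change eN c' ≫ (bcFunctor E ℂ).map (𝟙 _) = eN c'
    rw [CategoryTheory.Functor.map_id, Category.comp_id]
  have hpos : 0 < Nat.card {δ : Δ // act δ = 1} := Nat.card_pos_iff.2 ⟨⟨⟨1, map_one act⟩⟩, inferInstance⟩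
  simp only [hker] at hWt hdeck
  exact ⟨_, H, hfin, hq, ttH, hpos, rfl, httH, hWt, hdeck⟩

/-- **The trace word for a FAITHFUL rigid deck action: multiplicity ONE** — `exists_fan_traceWord_of_rigid` with `Function.Injective act`
(the faithful quotient `Δ/ker act`, ★ `exists_pushPull_package_inj`): `{δ | act δ = 1} = {1}`, so the trace word is
`Σ_{c′} πY_K (bN c′) ≫ ttH c′ ≫ ιY_N c′` with the `H`-pinned pull-backs `ttH c′` THEMSELVES as entries (the `tt`/`htt` of ★
`Jacobian.exists_entry_levelAdjoint`, no scaling), intertwining `t` and deck invariant.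
[cite: Lang1983AbelianVarieties, Ch. VIII §6, Thm. 13 (pp. 224–227)] [cite: LangeRodriguez2022, §3.5.1 Prop. 3.5.1 (p. 65)]
[cite: Milne2005ShimuraVarieties, §5 p. 57 L7–12 and Rem. 5.29 (c) p. 65] -/
theorem exists_fan_traceWord_of_rigid_injective (h : N ≤ K)
    {Δ : Type} [Group Δ] [Fintype Δ] (act : Δ →* Aut (C.X N)) (hinj : Function.Injective act)
    (hp : IsSepQuotient (fun δ => act δ) (C.cpt.X.map (homOfLE h)))
    (hPF : ∀ (δ : Δ) (P : SchemeOver ℂ) [Nonempty ↥P.left] (e : P ⟶ (bcFunctor E ℂ).obj (C.X N)) [IsOpenImmersion e.left],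
      e ≫ (bcFunctor E ℂ).map (act δ).hom = e → act δ = 1)
    (t : C.A K ⟶ C.A N)
    (ht : (C.alb N).map (C.alb K) (C.cpt.X.map (homOfLE h)) ≫ t = ∑ δ, (C.alb N).map (C.alb N) (act δ).hom)
    (hcN : IsColimit (Cofan.mk ((bcFunctor E ℂ).obj (C.X N)) eN)) (hEN : ∀ c, IsSmoothProjective 1 (EN c))
    (hcK : IsColimit (Cofan.mk ((bcFunctor E ℂ).obj (C.X K)) eK)) (hEK : ∀ c, IsSmoothProjective 1 (EK c))
    (htotN : ∑ c, πN c ≫ ιN c = 𝟙 YN) (hιπN : ∀ c, ιN c ≫ πN c = 𝟙 _) (hιπN' : ∀ c₁ c₂, c₁ ≠ c₂ → ιN c₁ ≫ πN c₂ = 0)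
    (htotK : ∑ c, πK c ≫ ιK c = 𝟙 YK) (hιπK : ∀ c, ιK c ≫ πK c = 𝟙 _) (hιπK' : ∀ c₁ c₂, c₁ ≠ c₂ → ιK c₁ ≫ πK c₂ = 0)
    (hlN : ∀ c, lN c ≫ (bcFunctor E ℂ).map (C.alb N).nabla.incl = (eN c ⊗ₘ eN c) ≫ Functor.LaxMonoidal.μ (bcFunctor E ℂ) (C.X N) (C.X N))
    (hlαN : ∀ c, lN c ≫ (bcFunctor E ℂ).map (C.alb N).α = (JN c).diff ≫ (ιN c ≫ vN).hom.hom.hom)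
    (hlK : ∀ c, lK c ≫ (bcFunctor E ℂ).map (C.alb K).nabla.incl = (eK c ⊗ₘ eK c) ≫ Functor.LaxMonoidal.μ (bcFunctor E ℂ) (C.X K) (C.X K))
    (hlαK : ∀ c, lK c ≫ (bcFunctor E ℂ).map (C.alb K).α = (JK c).diff ≫ (ιK c ≫ vK).hom.hom.hom)
    (bN : CN → CK) (tu : ∀ c', EN c' ⟶ EK (bN c'))
    (htu : ∀ c', tu c' ≫ eK (bN c') = eN c' ≫ (bcFunctor E ℂ).map (C.cpt.X.map (homOfLE h))) :
    ∃ (H : ∀ c', Subgroup (Aut (EN c'))) (_ : ∀ c', Finite ↥(H c'))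
      (_ : ∀ c', IsSepQuotient (fun h : ↥(H c') => (h : Aut (EN c'))) (tu c'))
      (ttH : ∀ c', (JK (bN c')).J ⟶ (JN c').J),
      (∀ c', haveI := Fintype.ofFinite ↥(H c');
        (JN c').pushforward (JK (bN c')) (tu c') ≫ ttH c' =
          ∑ h : ↥(H c'), (JN c').pushforward (JN c') (h : Aut (EN c')).hom) ∧
      (∑ c', πK (bN c') ≫ ttH c' ≫ ιN c') ≫ vN = vK ≫ AbelianVariety.Hom.baseChange ℂ t ∧
      (∀ (δ : Δ) (cs : CN → CN) (dk : ∀ c, EN c ⟶ EN (cs c)),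
        (∀ c, dk c ≫ eN (cs c) = eN c ≫ (bcFunctor E ℂ).map (act δ).hom) →
        (∑ c', πK (bN c') ≫ ttH c' ≫ ιN c') ≫ (∑ c, πN c ≫ (JN c).pushforward (JN (cs c)) (dk c) ≫ ιN (cs c)) =
          ∑ c', πK (bN c') ≫ ttH c' ≫ ιN c') := by
  obtain ⟨m₀, H, hfin, hq, ttH, -, hm₀, httH, hWt, hdeck⟩ :=
    exists_fan_traceWord_of_rigid EN eN JN YN πN ιN vN lN EK eK JK YK πK ιK vK lK h act hp hPF t ht hcN hEN hcK hEK htotN hιπN hιπN'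
      htotK hιπK hιπK' hlN hlαN hlK hlαK bN tu htu
  haveI : Unique {δ : Δ // act δ = 1} :=
    { default := ⟨1, map_one act⟩
      uniq := fun x => Subtype.ext (hinj (x.2.trans (map_one act).symm)) }
  have h1 : m₀ = 1 := hm₀.trans Nat.card_unique
  subst h1
  simp only [Nat.cast_one, one_smul] at hWt hdeck
  exact ⟨H, hfin, hq, ttH, httH, hWt, hdeck⟩

end Sec42Data.HeckeTranslates

end Sec42

end Literature.NumberTheory.Automorphic.Liu2021.AppendixC

end
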